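import Literature.IUT.LogVolume.IsometryMoverSlotAscent
import Literature.IUT.LogVolume.IsometryMoverAscentRoots
import HarnessLib

/-!
# Ascent of maximal-order movers into MIXED packets: the packet morphism
# `⊗_{s ∈ S} K'_s → ⊗_{i ∈ I} k_i` along slot embeddings `σ_s : K'_s → k_s` (`S ⊆ I`), `1`-padded off `S`

Classical multilinear / local algebra (nothing disputed; the [IUTchIV] locator records where the abc-iut cell uses
it).  [IUTchIV] Prop. 1.1 p. 9 attaches to a tensor packet `V_I = ⊗_{ℚ_p, i ∈ I} k_i` of `p`-adic fields — in the
proof of [IUTchIV] Thm. 1.10, Step (iv)–(v) (p. 27), the slots are the completions `K_{v_i}` at a collection of NOT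
NECESSARILY DISTINCT places `v_i`, so the slot fields are MIXED — the maximal `ℤ_p`-order `(R_I)^∼` (the tree's
`normalizedPacket` = integral closure of `ℤ_p` in `V_I`, abc-iut-S5's `mem_normalizedPacket_iff_isIntegral`).  A tuple
of factorwise `ℚ_p`-linear ISOMETRIES may MOVE `(R_I)^∼`.  The exhibits of record are TWO-slot movers `![g, 1]` over
`K ⊗ K` (`WildCubicIsometryMover`, `WildQuadraticIsometryMover`, `WildDyadicCyclotomicIsometryMover`, …, degree-free in
`IsometryMoverAscentRoots`); `IsometryMoverAscent` (abc-iut-E-t16) moves them along FIELD embeddings at a fixed index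
set, `IsometryMoverSlotAscent` (abc-iut-E-cx) along SLOT inclusions for a CONSTANT slot field.  THIS FILE does both
at once for MIXED slot fields: for a packet `⊗_{i ∈ I} k_i`, a finite set of slots `S ⊆ I`, small fields `K'_s`
(`s ∈ S`) and `ℚ_p`-algebra maps `σ_s : K'_s → k_s`,

* §1 a `ℚ_p`-ALGEBRA map `Φ : ⊗_{s ∈ S} K'_s → ⊗_{i ∈ I} k_i` with `Φ(ι_s a) = ι_s(σ_s a)` exists
  (`exists_algHom_iota`, `PiTensorProduct.liftAlgHom` of `x ↦ Π_s ι_s(σ_s x_s)`); on pure tensors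
  `Φ(⊗_s x_s) = ⊗_i x̃_i` with `x̃_s = σ_s x_s` on `S` and `x̃_i = 1` off `S` (`map_tprod`, `prod_mulSingle_apply`);
* §2 `Φ` has a `ℚ_p`-LINEAR left inverse (`exists_linear_leftInverse`: slotwise `ℚ_p`-linear retractions of the `σ_s`
  on `S`, a `ℚ_p`-linear functional `λ_i` with `λ_i(1) = 1` on every slot off `S`, multiplied together in the
  commutative algebra `⊗_{s ∈ S} K'_s`), hence is INJECTIVE and PRESERVES AND REFLECTS the maximal order,
  `Φ x ∈ (R_I)^∼ ↔ x ∈ (R_S)^∼` (`map_mem_normalizedPacket_iff`, integrality reflection along an injective algebra map);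
* §3 `Φ` INTERTWINES `⊗_s g_s` with `⊗_i G_i` whenever `G_s ∘ σ_s = σ_s ∘ g_s` on `S` and `G_i = id` off `S`
  (`congr_map_eq_map_congr`); such isometric `G` exist for isometric `g` (`exists_isometries_extend`, E-t16's
  `MoverAscent.exists_isometry_extension` slotwise — orthogonal complements over `ℚ_p`);
* §4 **MIXED ASCENT** (`exists_isometries_mover_of_mover`): if factorwise isometries `g_s` move some `z ∈ (R_S)^∼`
  out of `(R_S)^∼`, then factorwise isometries `G_i` of the `k_i` (extending the `g_s` along the `σ_s`, identity off
  `S`) move `Φ z ∈ (R_I)^∼` out of `(R_I)^∼`;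
* §5 the two-slot currency of record (`exists_isometries_mover_of_two_le_card`): a field `K` carrying a two-slot
  mover `![g, 1]` of `(R_{Fin 2})^∼ ⊆ K ⊗ K` which EMBEDS INTO AT LEAST TWO DISTINCT SLOTS of a mixed packet
  (`σ_s : K → k_s`, `s ∈ S`, `2 ≤ |S|`) yields factorwise isometries moving `(R_I)^∼ ⊆ ⊗_{i ∈ I} k_i`; examples of
  record: any `3`-adic packet two of whose slots contain a cube root of `3` (`…_of_cubeRoot`), any `2`-adic packet two
  of whose slots contain a square root of `2` (`…_of_sqrtTwo`).

Special cases BY NAME: `S = univ`, `K' = k`, general `σ` is `IsometryMoverAscent` §2–§3; constant `K' = k = K`,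
`σ = id` is `IsometryMoverSlotAscent`; `K'_s = k_s`, `σ = id` is the plain sub-packet inclusion for mixed fields
(`exists_subpacket_algHom`), which neither covers.  HONEST SCOPE: the SUFFICIENT direction only — a bad field
occupying a SINGLE slot of a mixed packet need not move it (block-E lane 2: `ℚ₂(√2) ⊗ ℚ₂(√−1)` is stable under all
factorwise isometries), and no necessity statement is made here.  Use (abc-iut cell, R-J row Y-29b, the
«mixed-packet» precision of the block-E adversary lanes): the MOVER half of the dyadic-axis word holds for print's
own (mixed) packet shape as soon as a mover field embeds into two slots.  Statement about CONTAINERS only; it takes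
no side on [IUTchIII] Cor. 3.12.  PROOF-ONLY file (theorems, no definitions, no `Prop` facts).
[cite: Mochizuki2012, IUTchIV Prop. 1.1 p. 9; Thm. 1.10 Step (iv)–(v) p. 27] [cite: NeukirchANT1999, Ch. II Thm. (4.8)]
[cite: WeilBNT1967, Ch. II §1, Prop. 2–3]
-/

noncomputable section

open Module Function Metric Set
open scoped TensorProduct

namespace Literature.IUT.LogVolume

namespace MixedSlotAscent

variable (p : ℕ) [Fact p.Prime]
variable {I : Type} [Fintype I] [DecidableEq I]
variable (k : I → Type) [∀ i, NontriviallyNormedField (k i)] [∀ i, NormedAlgebra ℚ_[p] (k i)]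
variable (S : Finset I)
variable (K' : S → Type) [∀ s, NontriviallyNormedField (K' s)] [∀ s, NormedAlgebra ℚ_[p] (K' s)]
variable (σ : ∀ s : S, K' s →ₐ[ℚ_[p]] k s)

/-! ## §1 The packet morphism along slot embeddings, `1`-padded off `S` -/

omit [Fintype I] in
/-- The padded family, pointwise: `(Π_s δ_s(σ_s x_s))_i` is `σ_s x_s` at a slot `i = s ∈ S` and `1` at a slot off `S`.
[folklore] -/
private theorem prod_mulSingle_apply (x : Π s, K' s) (i : I) :
    (∏ s : S, (Pi.mulSingle (s : I) (σ s (x s)) : Π i, k i)) i =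
      if h : i ∈ S then σ ⟨i, h⟩ (x ⟨i, h⟩) else 1 := by
  rw [Finset.prod_apply]
  by_cases h : i ∈ S
  · rw [dif_pos h, Finset.prod_eq_single ⟨i, h⟩]
    · exact Pi.mulSingle_eq_same _ _
    · intro s _ hs
      refine Pi.mulSingle_eq_of_ne (fun hi => hs ?_) _
      exact Subtype.ext hi.symm
    · intro hi; exact absurd (Finset.mem_univ _) hi
  · rw [dif_neg h]
    exact Finset.prod_eq_one fun s _ => Pi.mulSingle_eq_of_ne (fun hi : i = (s : I) => h (by rw [hi]; exact s.2)) _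

omit [Fintype I] in
/-- **The packet morphism along slot embeddings exists**: a `ℚ_p`-algebra homomorphism
`Φ : ⊗_{s ∈ S} K'_s → ⊗_{i ∈ I} k_i` with `Φ(ι_s(a)) = ι_s(σ_s a)` for every `s ∈ S` (the lift of the multiplicative
multilinear map `x ↦ Π_s ι_s(σ_s x_s)`; the slots off `S` are padded with `1`).
[cite: Mochizuki2012, IUTchIV Prop. 1.1 p. 9] -/
theorem exists_algHom_iota :
    ∃ Φ : PacketAlgebra p K' →ₐ[ℚ_[p]] PacketAlgebra p k,
      ∀ (s : S) (a : K' s), Φ (iota p K' s a) = iota p k s (σ s a) := by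
  let f : MultilinearMap ℚ_[p] K' (PacketAlgebra p k) :=
    (MultilinearMap.mkPiAlgebra ℚ_[p] S (PacketAlgebra p k)).compLinearMap
      fun s => ((iota p k (s : I)).comp (σ s)).toLinearMap
  have hf : ∀ x, f x = ∏ s : S, iota p k (s : I) (σ s (x s)) := fun x => by
    simp only [f, MultilinearMap.compLinearMap_apply, MultilinearMap.mkPiAlgebra_apply, AlgHom.toLinearMap_apply,
      AlgHom.coe_comp, Function.comp_apply]
  have hone : f 1 = 1 := by
    rw [hf]; exact Finset.prod_eq_one fun s _ => by rw [Pi.one_apply, map_one, map_one]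
  have hmul : ∀ x y, f (x * y) = f x * f y := fun x y => by
    rw [hf, hf, hf, ← Finset.prod_mul_distrib]
    exact Finset.prod_congr rfl fun s _ => by rw [Pi.mul_apply, map_mul, map_mul]
  refine ⟨PiTensorProduct.liftAlgHom f hone hmul, fun s a => ?_⟩
  rw [iota_eq_purePacket p K', purePacket, PiTensorProduct.liftAlgHom_apply, PiTensorProduct.lift.tprod, hf,
    Finset.prod_eq_single s]
  · rw [Pi.mulSingle_eq_same]
  · intro s' _ hs'
    rw [Pi.mulSingle_eq_of_ne hs', map_one, map_one]
  · intro h; exact absurd (Finset.mem_univ s) h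

section Phi

variable (Φ : PacketAlgebra p K' →ₐ[ℚ_[p]] PacketAlgebra p k)
  (hΦ : ∀ (s : S) (a : K' s), Φ (iota p K' s a) = iota p k s (σ s a))
include hΦ

omit [Fintype I] in
/-- **`Φ` on pure tensors**: `Φ(⊗_s x_s) = ⊗_i x̃_i`, `x̃ = Π_s δ_s(σ_s x_s)` (`x̃_s = σ_s x_s` on `S`, `x̃_i = 1` off `S`).
[cite: Mochizuki2012, IUTchIV Prop. 1.1 p. 9] -/
theorem map_tprod (x : Π s, K' s) :
    Φ (PiTensorProduct.tprod ℚ_[p] x) =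
      PiTensorProduct.tprod ℚ_[p] (∏ s : S, (Pi.mulSingle (s : I) (σ s (x s)) : Π i, k i)) := by
  show Φ (purePacket p K' x) = _
  rw [purePacket_eq_prod_iota, map_prod, PiTensorProduct.tprod_prod]
  exact Finset.prod_congr rfl fun s _ => hΦ s (x s)

/-! ## §2 A linear left inverse; injectivity; reflection of the maximal order -/

/-- **`Φ` has a `ℚ_p`-linear left inverse** `ρ : ⊗_I k_i → ⊗_S K'_s`, `ρ ∘ Φ = id`: `ρ(⊗_i y_i) = Π_i τ_i(y_i)` in the
commutative algebra `⊗_S K'_s`, where `τ_s = ι_s ∘ r_s` for a `ℚ_p`-linear retraction `r_s` of `σ_s` (`s ∈ S`) and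
`τ_i(y) = λ_i(y) · 1` for a `ℚ_p`-linear functional `λ_i` of `k_i` with `λ_i(1) = 1` (`i ∉ S`).
[cite: Mochizuki2012, IUTchIV Prop. 1.1 p. 9] -/
theorem exists_linear_leftInverse :
    ∃ ρ : PacketAlgebra p k →ₗ[ℚ_[p]] PacketAlgebra p K', ∀ x, ρ (Φ x) = x := by
  have hr : ∀ s : S, ∃ r : k s →ₗ[ℚ_[p]] K' s, r ∘ₗ (σ s).toLinearMap = LinearMap.id := fun s =>
    LinearMap.exists_leftInverse_of_injective _ (LinearMap.ker_eq_bot.mpr (σ s).toRingHom.injective)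
  choose r hr using hr
  have hl : ∀ i : I, ∃ l : k i →ₗ[ℚ_[p]] ℚ_[p], l ∘ₗ Algebra.linearMap ℚ_[p] (k i) = LinearMap.id := fun i =>
    LinearMap.exists_leftInverse_of_injective _
      (LinearMap.ker_eq_bot.mpr (algebraMap ℚ_[p] (k i)).injective)
  choose l hl using hl
  have hr' : ∀ (s : S) (a : K' s), r s (σ s a) = a := fun s a => by
    simpa using LinearMap.congr_fun (hr s) a
  have hl' : ∀ i : I, l i 1 = 1 := fun i => by
    simpa using LinearMap.congr_fun (hl i) 1
  let τ : ∀ i, k i →ₗ[ℚ_[p]] PacketAlgebra p K' := fun i =>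
    if h : i ∈ S then (iota p K' ⟨i, h⟩).toLinearMap ∘ₗ r ⟨i, h⟩ else (l i).smulRight 1
  have hτS : ∀ (s : S) (a : K' s), τ s (σ s a) = iota p K' s a := by
    rintro ⟨i, h⟩ a
    simp only [τ, dif_pos h, LinearMap.coe_comp, Function.comp_apply, AlgHom.toLinearMap_apply, hr']
  have hτ1 : ∀ i, i ∉ S → τ i 1 = 1 := fun i h => by
    simp only [τ, dif_neg h, LinearMap.smulRight_apply, hl', one_smul]
  let g : MultilinearMap ℚ_[p] k (PacketAlgebra p K') :=
    (MultilinearMap.mkPiAlgebra ℚ_[p] I (PacketAlgebra p K')).compLinearMap τ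
  have hg : ∀ y, g y = ∏ i, τ i (y i) := fun y => by
    simp only [g, MultilinearMap.compLinearMap_apply, MultilinearMap.mkPiAlgebra_apply]
  refine ⟨PiTensorProduct.lift g, fun x => ?_⟩
  have h : PiTensorProduct.lift g ∘ₗ Φ.toLinearMap = LinearMap.id := by
    refine PiTensorProduct.ext ?_
    refine MultilinearMap.ext fun x => ?_
    simp only [LinearMap.compMultilinearMap_apply, LinearMap.coe_comp, Function.comp_apply,
      AlgHom.toLinearMap_apply, LinearMap.id_apply]
    rw [map_tprod p k S K' σ Φ hΦ, PiTensorProduct.lift.tprod, hg]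
    have hfac : ∀ i, τ i ((∏ s : S, (Pi.mulSingle (s : I) (σ s (x s)) : Π i, k i)) i) =
        if h : i ∈ S then iota p K' ⟨i, h⟩ (x ⟨i, h⟩) else 1 := fun i => by
      rw [prod_mulSingle_apply]
      by_cases h : i ∈ S
      · rw [dif_pos h, dif_pos h]; exact hτS ⟨i, h⟩ (x ⟨i, h⟩)
      · rw [dif_neg h, dif_neg h]; exact hτ1 i h
    rw [Finset.prod_congr rfl fun i _ => hfac i,
      ← Finset.prod_subset (Finset.subset_univ S) fun i _ hi => by rw [dif_neg hi],
      ← Finset.prod_coe_sort]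
    show ∏ s : S, _ = purePacket p K' x
    rw [purePacket_eq_prod_iota]
    exact Finset.prod_congr rfl fun s _ => by rw [dif_pos s.2]
  exact LinearMap.congr_fun h x

/-- **`Φ` is injective.** [cite: Mochizuki2012, IUTchIV Prop. 1.1 p. 9] -/
theorem injective : Function.Injective Φ := by
  obtain ⟨ρ, hρ⟩ := exists_linear_leftInverse p k S K' σ Φ hΦ
  exact Function.LeftInverse.injective hρ

/-- **`Φ` preserves and reflects the maximal order**: `Φ x ∈ (R_I)^∼ ↔ x ∈ (R_S)^∼` (both are integral closures of
`ℤ_p`; integrality is preserved by algebra maps and reflected by injective ones).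
[cite: Mochizuki2012, IUTchIV Prop. 1.1 p. 9] -/
theorem map_mem_normalizedPacket_iff [Nonempty S] [Nonempty I] [∀ i, IsUltrametricDist (k i)]
    [∀ i, ProperSpace (k i)] [∀ s, IsUltrametricDist (K' s)] [∀ s, ProperSpace (K' s)]
    {x : PacketAlgebra p K'} :
    Φ x ∈ normalizedPacket p k ↔ x ∈ normalizedPacket p K' := by
  rw [mem_normalizedPacket_iff_isIntegral, mem_normalizedPacket_iff_isIntegral]
  exact isIntegral_algHom_iff (Φ.restrictScalars ℤ_[p]) (injective p k S K' σ Φ hΦ)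

/-! ## §3 Intertwining with factorwise maps; extension of factorwise isometries -/

omit [Fintype I] in
/-- **Intertwining**: if `G_s ∘ σ_s = σ_s ∘ g_s` on `S` and `G_i = id` off `S`, then `(⊗_i G_i) ∘ Φ = Φ ∘ (⊗_s g_s)`
(check on pure tensors: both sides send `⊗_s x_s` to `⊗_i ỹ_i`, `ỹ_s = σ_s(g_s x_s)` on `S`, `ỹ_i = 1` off `S`).
[cite: Mochizuki2012, IUTchIV Prop. 1.1 p. 9] -/
theorem congr_map_eq_map_congr (g : ∀ s : S, K' s ≃ₗ[ℚ_[p]] K' s) (G : ∀ i, k i ≃ₗ[ℚ_[p]] k i)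
    (hG : ∀ (s : S) (a : K' s), G s (σ s a) = σ s (g s a))
    (hG1 : ∀ i, i ∉ S → G i = LinearEquiv.refl ℚ_[p] (k i)) (z : PacketAlgebra p K') :
    PiTensorProduct.congr G (Φ z) = Φ (PiTensorProduct.congr g z) := by
  have h : (PiTensorProduct.congr G : PacketAlgebra p k ≃ₗ[ℚ_[p]] PacketAlgebra p k).toLinearMap ∘ₗ
        Φ.toLinearMap =
      Φ.toLinearMap ∘ₗ
        (PiTensorProduct.congr g : PacketAlgebra p K' ≃ₗ[ℚ_[p]] PacketAlgebra p K').toLinearMap := by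
    refine PiTensorProduct.ext ?_
    refine MultilinearMap.ext fun x => ?_
    simp only [LinearMap.compMultilinearMap_apply, LinearMap.coe_comp, Function.comp_apply,
      LinearEquiv.coe_coe, AlgHom.toLinearMap_apply, PiTensorProduct.congr_tprod]
    rw [map_tprod p k S K' σ Φ hΦ, map_tprod p k S K' σ Φ hΦ, PiTensorProduct.congr_tprod]
    congr 1
    funext i
    rw [prod_mulSingle_apply, prod_mulSingle_apply]
    by_cases hi : i ∈ S
    · rw [dif_pos hi, dif_pos hi]
      exact hG ⟨i, hi⟩ (x ⟨i, hi⟩)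
    · rw [dif_neg hi, dif_neg hi, hG1 i hi]
      rfl
  exact LinearMap.congr_fun h z

end Phi

omit [Fintype I] in
/-- **Factorwise isometries extend from the sub-packet**: for `ℚ_p`-linear isometries `g_s` of the `K'_s` (`s ∈ S`)
there are `ℚ_p`-linear isometries `G_i` of the `k_i` with `G_s ∘ σ_s = σ_s ∘ g_s` on `S` (E-t16's extension of
isometries along the isometric `σ_s`, orthogonal complements over `ℚ_p`) and `G_i = id` off `S`.
[cite: WeilBNT1967, Ch. II §1, Prop. 2–3] [cite: NeukirchANT1999, Ch. II Thm. (4.8)] -/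
theorem exists_isometries_extend [∀ i, IsUltrametricDist (k i)] [∀ i, ProperSpace (k i)]
    [∀ s, ProperSpace (K' s)] (g : ∀ s : S, K' s ≃ₗ[ℚ_[p]] K' s) (hg : ∀ s x, ‖g s x‖ = ‖x‖) :
    ∃ G : ∀ i, k i ≃ₗ[ℚ_[p]] k i, (∀ i y, ‖G i y‖ = ‖y‖) ∧ (∀ (s : S) (a : K' s), G s (σ s a) = σ s (g s a)) ∧
      ∀ i, i ∉ S → G i = LinearEquiv.refl ℚ_[p] (k i) := by
  have hG : ∀ s : S, ∃ G : k s ≃ₗ[ℚ_[p]] k s, (∀ a, G (σ s a) = σ s (g s a)) ∧ ∀ y, ‖G y‖ = ‖y‖ := by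
    intro s
    haveI : FiniteDimensional ℚ_[p] (k s) := FiniteDimensional.of_locallyCompactSpace ℚ_[p]
    exact MoverAscent.exists_isometry_extension (σ s).toLinearMap (norm_map_algHom (σ s)) (g s) (hg s)
  choose Gs hGσ hGn using hG
  refine ⟨fun i => if h : i ∈ S then Gs ⟨i, h⟩ else LinearEquiv.refl ℚ_[p] (k i), fun i y => ?_, ?_,
    fun i hi => dif_neg hi⟩
  · by_cases h : i ∈ S
    · simp only [dif_pos h]; exact hGn ⟨i, h⟩ y
    · simp only [dif_neg h, LinearEquiv.refl_apply]
  · rintro ⟨i, h⟩ a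
    show (dite (i ∈ S) (fun h => Gs ⟨i, h⟩) fun _ => LinearEquiv.refl ℚ_[p] (k i)) (σ ⟨i, h⟩ a) = _
    rw [dif_pos h]
    exact hGσ ⟨i, h⟩ a

/-! ## §4 Mixed ascent of movers -/

/-- **MIXED ASCENT OF MAXIMAL-ORDER MOVERS.**  Packet `⊗_{i ∈ I} k_i` with mixed slot fields, slots `S ⊆ I`, small
fields `K'_s` with `ℚ_p`-algebra maps `σ_s : K'_s → k_s`.  If factorwise `ℚ_p`-linear ISOMETRIES `g_s` (`s ∈ S`) move a
point `z ∈ (R_S)^∼ ⊆ ⊗_{s ∈ S} K'_s` out of `(R_S)^∼`, then there are factorwise `ℚ_p`-linear ISOMETRIES `G_i` of the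
`k_i`, extending the `g_s` along the `σ_s` on `S` and equal to the identity off `S`, and a point `Z ∈ (R_I)^∼`
(`Z = Φ z`) with `(⊗_i G_i) Z ∉ (R_I)^∼`. [cite: Mochizuki2012, IUTchIV Prop. 1.1 p. 9]
[cite: NeukirchANT1999, Ch. II Thm. (4.8)] [cite: WeilBNT1967, Ch. II §1, Prop. 2–3] -/
theorem exists_isometries_mover_of_mover [Nonempty S] [∀ i, IsUltrametricDist (k i)] [∀ i, ProperSpace (k i)]
    [∀ s, IsUltrametricDist (K' s)] [∀ s, ProperSpace (K' s)]
    (g : ∀ s : S, K' s ≃ₗ[ℚ_[p]] K' s) (hg : ∀ s x, ‖g s x‖ = ‖x‖)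
    {z : PacketAlgebra p K'} (hz : z ∈ normalizedPacket p K')
    (hmv : PiTensorProduct.congr g z ∉ normalizedPacket p K') :
    ∃ G : ∀ i, k i ≃ₗ[ℚ_[p]] k i, (∀ i y, ‖G i y‖ = ‖y‖) ∧ (∀ (s : S) (a : K' s), G s (σ s a) = σ s (g s a)) ∧
      (∀ i, i ∉ S → G i = LinearEquiv.refl ℚ_[p] (k i)) ∧
      ∃ Z : PacketAlgebra p k, Z ∈ normalizedPacket p k ∧ PiTensorProduct.congr G Z ∉ normalizedPacket p k := by
  haveI : Nonempty I := ⟨((Classical.arbitrary S : S) : I)⟩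
  obtain ⟨Φ, hΦ⟩ := exists_algHom_iota p k S K' σ
  obtain ⟨G, hGn, hGσ, hG1⟩ := exists_isometries_extend p k S K' σ g hg
  refine ⟨G, hGn, hGσ, hG1, Φ z, (map_mem_normalizedPacket_iff p k S K' σ Φ hΦ).mpr hz, fun hmem => hmv ?_⟩
  rw [congr_map_eq_map_congr p k S K' σ Φ hΦ g G hGσ hG1 z] at hmem
  exact (map_mem_normalizedPacket_iff p k S K' σ Φ hΦ).mp hmem

/-- **The plain sub-packet inclusion for mixed fields** (`K'_s = k_s`, `σ = id`): a packet morphism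
`Φ : ⊗_{s ∈ S} k_s → ⊗_{i ∈ I} k_i` with `Φ(ι_s a) = ι_s a` exists, is injective, and preserves and reflects the maximal
order. [cite: Mochizuki2012, IUTchIV Prop. 1.1 p. 9] -/
theorem exists_subpacket_algHom [Nonempty S] [∀ i, IsUltrametricDist (k i)] [∀ i, ProperSpace (k i)] :
    ∃ Φ : PacketAlgebra p (fun s : S => k s) →ₐ[ℚ_[p]] PacketAlgebra p k,
      (∀ (s : S) (a : k s), Φ (iota p (fun s : S => k s) s a) = iota p k s a) ∧ Function.Injective Φ ∧
        ∀ x, Φ x ∈ normalizedPacket p k ↔ x ∈ normalizedPacket p (fun s : S => k s) := by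
  haveI : Nonempty I := ⟨((Classical.arbitrary S : S) : I)⟩
  obtain ⟨Φ, hΦ⟩ := exists_algHom_iota p k S (fun s : S => k s) fun s => AlgHom.id ℚ_[p] (k s)
  exact ⟨Φ, fun s a => hΦ s a, injective p k S (fun s : S => k s) (fun s => AlgHom.id ℚ_[p] (k s)) Φ hΦ,
    fun x => map_mem_normalizedPacket_iff p k S (fun s : S => k s) (fun s => AlgHom.id ℚ_[p] (k s)) Φ hΦ⟩

end MixedSlotAscent

/-! ## §5 The two-slot currency of record: a mover field embedded into two slots of a mixed packet -/

namespace MixedSlotAscent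

variable (p : ℕ) [Fact p.Prime]
variable {I : Type} [Fintype I] [DecidableEq I]
variable (k : I → Type) [∀ i, NontriviallyNormedField (k i)] [∀ i, NormedAlgebra ℚ_[p] (k i)]
  [∀ i, IsUltrametricDist (k i)] [∀ i, ProperSpace (k i)]
variable {K : Type} [NontriviallyNormedField K] [NormedAlgebra ℚ_[p] K] [IsUltrametricDist K] [ProperSpace K]

/-- **A MOVER FIELD EMBEDDED INTO TWO SLOTS MOVES A MIXED PACKET.**  If over a `p`-adic field `K` a two-slot mover of
record is given — a `ℚ_p`-linear isometry `g` and `z ∈ (R_{Fin 2})^∼ ⊆ K ⊗ K` with `(g ⊗ 1) z ∉ (R_{Fin 2})^∼` — and `K`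
embeds (`ℚ_p`-algebra maps `σ_s : K → k_s`) into every slot of a set `S` of AT LEAST TWO slots of a mixed packet
`⊗_{i ∈ I} k_i`, then factorwise `ℚ_p`-linear isometries of the `k_i` move `(R_I)^∼` (slot ascent `Fin 2 ↪ S` at the
constant field `K`, then mixed ascent along the `σ_s`).  The sufficient direction only: a mover field occupying a
single slot need not move the packet. [cite: Mochizuki2012, IUTchIV Prop. 1.1 p. 9; Thm. 1.10 Step (iv)–(v) p. 27]
[cite: NeukirchANT1999, Ch. II Thm. (4.8)] -/
theorem exists_isometries_mover_of_two_le_card (S : Finset I) (hS : 2 ≤ S.card) (σ : ∀ s : S, K →ₐ[ℚ_[p]] k s)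
    (g : K ≃ₗ[ℚ_[p]] K) (hg : ∀ x, ‖g x‖ = ‖x‖) {z : PacketAlgebra p (fun _ : Fin 2 => K)}
    (hz : z ∈ (normalizedPacket p (fun _ : Fin 2 => K) : Set (PacketAlgebra p (fun _ : Fin 2 => K))))
    (hmv : (PiTensorProduct.congr (![g, LinearEquiv.refl ℚ_[p] K] : ∀ _ : Fin 2, K ≃ₗ[ℚ_[p]] K) :
        PacketAlgebra p (fun _ : Fin 2 => K) ≃ₗ[ℚ_[p]] PacketAlgebra p (fun _ : Fin 2 => K)) z ∉
      (normalizedPacket p (fun _ : Fin 2 => K) : Set (PacketAlgebra p (fun _ : Fin 2 => K)))) :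
    ∃ G : ∀ i, k i ≃ₗ[ℚ_[p]] k i, (∀ i y, ‖G i y‖ = ‖y‖) ∧ (∀ i, i ∉ S → G i = LinearEquiv.refl ℚ_[p] (k i)) ∧
      ∃ Z : PacketAlgebra p k, Z ∈ normalizedPacket p k ∧ PiTensorProduct.congr G Z ∉ normalizedPacket p k := by
  have hcard : 2 ≤ Fintype.card S := by rwa [Fintype.card_coe]
  haveI : Nonempty S := Fintype.card_pos_iff.mp (lt_of_lt_of_le two_pos hcard)
  obtain ⟨F, hFn, Z₁, hZ₁, hmv₁⟩ := SlotAscent.exists_isometries_mover_of_two_le_card p (I := S) hcard g hg hz hmv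
  obtain ⟨G, hGn, -, hG1, Z, hZ, hmvZ⟩ :=
    exists_isometries_mover_of_mover p k S (fun _ : S => K) σ F hFn (z := Z₁) hZ₁ hmv₁
  exact ⟨G, hGn, hG1, Z, hZ, hmvZ⟩

/-- **Two named slots.**  The same with the two receiving slots named: `i₀ ≠ i₁` in `I`, `ℚ_p`-algebra maps
`σ₀ : K → k_{i₀}`, `σ₁ : K → k_{i₁}`, and a two-slot mover `![g, 1]` over `K` give factorwise `ℚ_p`-linear isometries of
the `k_i`, equal to the identity at every slot other than `i₀, i₁`, moving `(R_I)^∼` — «two slots carrying a common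
mover field up to extension suffice». [cite: Mochizuki2012, IUTchIV Prop. 1.1 p. 9; Thm. 1.10 Step (iv)–(v) p. 27] -/
theorem exists_isometries_mover_of_two_slots {i₀ i₁ : I} (hne : i₀ ≠ i₁) (σ₀ : K →ₐ[ℚ_[p]] k i₀)
    (σ₁ : K →ₐ[ℚ_[p]] k i₁) (g : K ≃ₗ[ℚ_[p]] K) (hg : ∀ x, ‖g x‖ = ‖x‖) {z : PacketAlgebra p (fun _ : Fin 2 => K)}
    (hz : z ∈ (normalizedPacket p (fun _ : Fin 2 => K) : Set (PacketAlgebra p (fun _ : Fin 2 => K))))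
    (hmv : (PiTensorProduct.congr (![g, LinearEquiv.refl ℚ_[p] K] : ∀ _ : Fin 2, K ≃ₗ[ℚ_[p]] K) :
        PacketAlgebra p (fun _ : Fin 2 => K) ≃ₗ[ℚ_[p]] PacketAlgebra p (fun _ : Fin 2 => K)) z ∉
      (normalizedPacket p (fun _ : Fin 2 => K) : Set (PacketAlgebra p (fun _ : Fin 2 => K)))) :
    ∃ G : ∀ i, k i ≃ₗ[ℚ_[p]] k i, (∀ i y, ‖G i y‖ = ‖y‖) ∧
      (∀ i, i ≠ i₀ → i ≠ i₁ → G i = LinearEquiv.refl ℚ_[p] (k i)) ∧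
      ∃ Z : PacketAlgebra p k, Z ∈ normalizedPacket p k ∧ PiTensorProduct.congr G Z ∉ normalizedPacket p k := by
  let S : Finset I := {i₀, i₁}
  have hmem : ∀ s : S, (s : I) ≠ i₀ → (s : I) = i₁ := fun s h =>
    Finset.mem_singleton.mp ((Finset.mem_insert.mp s.2).resolve_left h)
  let σ : ∀ s : S, K →ₐ[ℚ_[p]] k s := fun s =>
    if h : (s : I) = i₀ then h ▸ σ₀ else (hmem s h) ▸ σ₁
  have hS : 2 ≤ S.card := by rw [Finset.card_pair hne]
  obtain ⟨G, hGn, hG1, Z, hZ, hmvZ⟩ := exists_isometries_mover_of_two_le_card p k S hS σ g hg hz hmv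
  refine ⟨G, hGn, fun i h₀ h₁ => hG1 i ?_, Z, hZ, hmvZ⟩
  intro hi
  rcases Finset.mem_insert.mp hi with h | h
  · exact h₀ h
  · exact h₁ (Finset.mem_singleton.mp h)

end MixedSlotAscent

namespace MixedSlotAscent

/-- **Example of record, `p = 3`**: a mixed `3`-adic packet `⊗_{i ∈ I} k_i` at least two of whose slots receive a
`3`-adic field `K ∋ π`, `π³ = 3` (so: two slots each containing a cube root of `3` inside a common such `K`), is MOVED
by factorwise `ℚ₃`-linear isometries (`IsometryMoverAscentRoots.exists_isometry_maxOrder_mover_of_cubeRoot` + mixed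
ascent). [cite: Mochizuki2012, IUTchIV Prop. 1.1 p. 9] [cite: NeukirchANT1999, Ch. II (5.5)] -/
theorem exists_isometries_mover_of_cubeRoot {I : Type} [Fintype I] [DecidableEq I] (k : I → Type)
    [∀ i, NontriviallyNormedField (k i)] [∀ i, NormedAlgebra ℚ_[3] (k i)] [∀ i, IsUltrametricDist (k i)]
    [∀ i, ProperSpace (k i)] {K : Type} [NontriviallyNormedField K] [NormedAlgebra ℚ_[3] K] [IsUltrametricDist K]
    [ProperSpace K] {π : K} (hπ : π ^ 3 = 3) (S : Finset I) (hS : 2 ≤ S.card) (σ : ∀ s : S, K →ₐ[ℚ_[3]] k s) :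
    ∃ G : ∀ i, k i ≃ₗ[ℚ_[3]] k i, (∀ i y, ‖G i y‖ = ‖y‖) ∧ (∀ i, i ∉ S → G i = LinearEquiv.refl ℚ_[3] (k i)) ∧
      ∃ Z : PacketAlgebra 3 k, Z ∈ normalizedPacket 3 k ∧ PiTensorProduct.congr G Z ∉ normalizedPacket 3 k := by
  obtain ⟨g, hg, -, z, hz, hmv⟩ := exists_isometry_maxOrder_mover_of_cubeRoot (K := K) hπ
  exact exists_isometries_mover_of_two_le_card 3 k S hS σ g hg hz hmv

/-- **Example of record, `p = 2` (the dyadic axis of R-J row Y-29b)**: a mixed `2`-adic packet `⊗_{i ∈ I} k_i` at least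
two of whose slots receive a `2`-adic field `K ∋ π`, `π² = 2`, is MOVED by factorwise `ℚ₂`-linear isometries
(`IsometryMoverAscentRoots.exists_isometry_maxOrder_mover_of_sqrtTwo` + mixed ascent).
[cite: Mochizuki2012, IUTchIV Prop. 1.1 p. 9] [cite: NeukirchANT1999, Ch. II (5.5)] -/
theorem exists_isometries_mover_of_sqrtTwo {I : Type} [Fintype I] [DecidableEq I] (k : I → Type)
    [∀ i, NontriviallyNormedField (k i)] [∀ i, NormedAlgebra ℚ_[2] (k i)] [∀ i, IsUltrametricDist (k i)]
    [∀ i, ProperSpace (k i)] {K : Type} [NontriviallyNormedField K] [NormedAlgebra ℚ_[2] K] [IsUltrametricDist K]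
    [ProperSpace K] {π : K} (hπ : π ^ 2 = 2) (S : Finset I) (hS : 2 ≤ S.card) (σ : ∀ s : S, K →ₐ[ℚ_[2]] k s) :
    ∃ G : ∀ i, k i ≃ₗ[ℚ_[2]] k i, (∀ i y, ‖G i y‖ = ‖y‖) ∧ (∀ i, i ∉ S → G i = LinearEquiv.refl ℚ_[2] (k i)) ∧
      ∃ Z : PacketAlgebra 2 k, Z ∈ normalizedPacket 2 k ∧ PiTensorProduct.congr G Z ∉ normalizedPacket 2 k := by
  obtain ⟨g, hg, -, z, hz, hmv⟩ := exists_isometry_maxOrder_mover_of_sqrtTwo (K := K) hπ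
  exact exists_isometries_mover_of_two_le_card 2 k S hS σ g hg hz hmv

/-- **Example of record, `p = 2`, two named slots**: slots `i₀ ≠ i₁` of a mixed `2`-adic packet both receiving a
`2`-adic field `K ∋ π`, `π² = 2` (e.g. both slot fields contain `√2` and a common such `K`), give factorwise
`ℚ₂`-linear isometries, the identity off `{i₀, i₁}`, moving `(R_I)^∼`.
[cite: Mochizuki2012, IUTchIV Prop. 1.1 p. 9; Thm. 1.10 Step (iv)–(v) p. 27] [cite: NeukirchANT1999, Ch. II (5.5)] -/
theorem exists_isometries_mover_of_sqrtTwo_two_slots {I : Type} [Fintype I] [DecidableEq I] (k : I → Type)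
    [∀ i, NontriviallyNormedField (k i)] [∀ i, NormedAlgebra ℚ_[2] (k i)] [∀ i, IsUltrametricDist (k i)]
    [∀ i, ProperSpace (k i)] {K : Type} [NontriviallyNormedField K] [NormedAlgebra ℚ_[2] K] [IsUltrametricDist K]
    [ProperSpace K] {π : K} (hπ : π ^ 2 = 2) {i₀ i₁ : I} (hne : i₀ ≠ i₁) (σ₀ : K →ₐ[ℚ_[2]] k i₀)
    (σ₁ : K →ₐ[ℚ_[2]] k i₁) :
    ∃ G : ∀ i, k i ≃ₗ[ℚ_[2]] k i, (∀ i y, ‖G i y‖ = ‖y‖) ∧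
      (∀ i, i ≠ i₀ → i ≠ i₁ → G i = LinearEquiv.refl ℚ_[2] (k i)) ∧
      ∃ Z : PacketAlgebra 2 k, Z ∈ normalizedPacket 2 k ∧ PiTensorProduct.congr G Z ∉ normalizedPacket 2 k := by
  obtain ⟨g, hg, -, z, hz, hmv⟩ := exists_isometry_maxOrder_mover_of_sqrtTwo (K := K) hπ
  exact exists_isometries_mover_of_two_slots 2 k hne σ₀ σ₁ g hg hz hmv

end MixedSlotAscent

end Literature.IUT.LogVolume

end
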